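import Mathlib

/-!
# Route «KPlusLogSqLaw» — static tridiagonal designs as path item lines (definitions)

HONEST FRAMING.  Definitions file (D-0009: reviewed/audited) for the transfer of the kernel static-path `O(n log n)` law
(`…Theorems.KPlusLogSqLaw.StaticPathFold.chain_le`, seat val-sym-lift-p3 g6, 2026-08-27) to dominant chains of STATIC TRIDIAGONAL dominance
designs in the tree's vocabulary (`tropWeight`, `termSign`, `IsDominant` of `MatrixDescartesFalseOfTropicalMonster.lean`), a helper line
toward the crux `WeakLifting` (item `stmt-ValiantsHypothesis-19561`, route `KPlusLogSqLaw`) on its witness-plan stub `stub_tridiagonalSectorB`.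
It names: the extension `extN σ` of a permutation of `Fin m` to `ℕ`; the SWAP SET `swapSet σ ⊆ {1, …, m-1}` (item `t` = «column `t-1` is
sent to row `t`»); and, for a class table `cls : Fin m → Fin m → Fin K` (the unique class carried by each entry of a STATIC design), the
entry scores `dN`, `vN` extended by `0` to `ℕ × ℕ` and the PATH ITEM LINES `itemSlope cls d t`, `itemIcpt cls v t` of the swap `t`
(= the two off-diagonal entries minus the two diagonal entries it replaces).  No `Prop` about the route is asserted; nothing here bears on
`WeakLifting`, `TropicalB`, `KPlusLogSqLaw`, `MatrixDescartes` (stmt-ValiantsHypothesis-18050) or `VP ≠ VNP`.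

[folklore] (matchings of a path as involutions; bookkeeping).
-/

set_option linter.dupNamespace false
set_option autoImplicit false

namespace Summit.ValiantsHypothesis.ValiantsHypothesis.Theorems.KPlusLogSqLaw

namespace StaticTridiagonal

open Finset Classical

noncomputable section

variable {m K : ℕ}

/-- a permutation of `Fin m` extended to `ℕ` by the identity. [folklore] -/
def extN (σ : Equiv.Perm (Fin m)) (t : ℕ) : ℕ := if h : t < m then ((σ ⟨t, h⟩ : Fin m) : ℕ) else t

/-- the SWAP SET of a permutation: the items `t ∈ {1, …, m-1}` with `σ (t-1) = t`. [folklore] -/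
def swapSet (σ : Equiv.Perm (Fin m)) : Finset ℕ := (Finset.Ioc 0 (m - 1)).filter fun t => extN σ (t - 1) = t

/-- the exponent of the class carried by entry `(r, c)`, as a real, extended by `0`. [folklore] -/
def dN (cls : Fin m → Fin m → Fin K) (d : Fin K → ℕ) (r c : ℕ) : ℝ :=
  if h : r < m ∧ c < m then (d (cls ⟨r, h.1⟩ ⟨c, h.2⟩) : ℝ) else 0

/-- the valuation of entry `(r, c)` at its class, as a real, extended by `0`. [folklore] -/
def vN (cls : Fin m → Fin m → Fin K) (v : Fin m → Fin m → Fin K → ℤ) (r c : ℕ) : ℝ :=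
  if h : r < m ∧ c < m then (v ⟨r, h.1⟩ ⟨c, h.2⟩ (cls ⟨r, h.1⟩ ⟨c, h.2⟩) : ℝ) else 0

/-- slope of the item line of the swap `t`: exponents of the two off-diagonal entries minus those of the two diagonal entries. [folklore] -/
def itemSlope (cls : Fin m → Fin m → Fin K) (d : Fin K → ℕ) (t : ℕ) : ℝ :=
  dN cls d t (t - 1) + dN cls d (t - 1) t - dN cls d (t - 1) (t - 1) - dN cls d t t

/-- intercept of the item line of the swap `t`: minus the corresponding combination of valuations. [folklore] -/
def itemIcpt (cls : Fin m → Fin m → Fin K) (v : Fin m → Fin m → Fin K → ℤ) (t : ℕ) : ℝ :=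
  -(vN cls v t (t - 1) + vN cls v (t - 1) t - vN cls v (t - 1) (t - 1) - vN cls v t t)

end

end StaticTridiagonal

end Summit.ValiantsHypothesis.ValiantsHypothesis.Theorems.KPlusLogSqLaw
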